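import Summits.CriticalPhenomena.SAWScalingLimit.Theses.SAWMassiveIsingTilt
import Summits.CriticalPhenomena.SAWScalingLimit.Theorems.SAWMassiveIsingTiltDefs
import Summits.CriticalPhenomena.SAWScalingLimit.Theorems.SAWMassiveIsingTiltTiltLawBasic
import Summits.CriticalPhenomena.SAWScalingLimit.Theorems.SAWMassiveIsingTiltHexEndpointApproxExists
import Summits.CriticalPhenomena.SAWScalingLimit.Theorems.SAWMassiveIsingTiltMassiveWindowSLEStubNoTouchOfNearTouchEstimate
import Summits.CriticalPhenomena.SAWScalingLimit.Theorems.SAWMassiveIsingTiltMassiveWindowSLEStubWindowNesting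
import Summits.CriticalPhenomena.SAWScalingLimit.Theorems.SAWRenewalTightnessShellCrossingBoundSocketTransfer
import Summits.CriticalPhenomena.SAWScalingLimit.Theorems.ObservableToSLE.Negative.EndpointNecessity
import HarnessLib

/-!
# Crux `MassiveWindowSLE` (stmt-CriticalPhenomena-7685), line `registered` (skeleton r8):
stub `stub_windowLimitChordal` — window limits are chordal (portmanteau)

Route `SAWMassiveIsingTilt` of `CriticalPhenomena/SAWScalingLimit`; stub Ch of the line
`registered`. Skeleton r8: the corrected statement (with the hypotheses `m δ·δ → 0` and
`∀ᶠ δ in 𝓝[>] 0, 0 < x δ`) is now the registered stub `stub_windowLimitChordal`, proved below;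
the r7 form (no such hypotheses) is refuted by `x := 0` (`ch_not_stub_windowLimitChordal`).
Objects: the tilted interface law `tiltLaw` of
`Theorems/SAWMassiveIsingTiltDefs.lean`, the window laws
`tiltLaw D.carrier δ (x δ) (1/√3 − m δ·δ) (a δ) (b δ)` pushed to `CurveClass ℂ` by `γ ↦ γ.curve`, a
family `P : ChordalFamily` which is their weak limit (`TendstoLaw`) for every Dobrushin domain `D`
and every hexagonal endpoint approximation `(a, b)`, and `ChordalFamily.IsChordal`.

## Finding: the r7 signature was FALSE (`ch_not_stub_windowLimitChordal`)

The r7 stub quantified over ALL tilts `x : ℝ → ℝ` and had no hypothesis making the window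
laws non-degenerate. At fugacity `x δ = 0` every SAW has weight `0 ^ ℓ(γ) = 0` (`ℓ ≥ 1`), so
`tilt = 0` and `tiltLaw = 0⁻¹ • 0 = 0` (`ch_tiltLaw_zero_fugacity`); with `P := 0` both sides of
`TendstoLaw` are the constant `0`, so the hypothesis holds, while `IsChordal 0` fails
(`0 univ ≠ 1`, instantiated at `DobrushinDomain.unitDisc`). Witness: `m := 0`, `x := 0`, `P := 0`.

## The corrected statements (proved here, sorry-free)

* `stub_windowLimitChordal` (the registered stub of skeleton r8) — add the two hypotheses
  `m δ·δ → 0` (already a clause of the neighbouring stubs) and `∀ᶠ δ in 𝓝[>] 0, 0 < x δ` (the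
  tilt is a positive fugacity): then the window laws are probability measures for small `δ`
  (`isProbabilityMeasure_tiltLaw_of_reachable`: `x > 0`, `y = 1/√3 − m δ·δ ≥ 0`, endpoints joined),
  and the portmanteau argument below goes through.
* `ch_windowLimitChordal_of_prob` — alternatively add `∀ D, IsProbabilityMeasure (P D)`; then the
  window laws (each a probability measure or `0`) are eventually probability measures because their
  masses tend to `1` (`ntb_eventually_isProbabilityMeasure`).

Proof of chordality given eventual probability of the window laws (`ch_chordal_at`):
* mass: the test integral of `f ≡ 1` is the total mass, eventually `1`, and tends to
  `(P D).real univ`, so `P D univ = 1` (`ch_isProbabilityMeasure_of_tendstoLaw`);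
* endpoints: the polyline of a SAW starts at `δ·c(a δ) → D.pt 0` and ends at `δ·c(b δ) → D.pt 1`
  (`source_hexCurve`, `target_hexCurve` of `Theorems/ObservableToSLE/Negative/EndpointNecessity`),
  so for every `r > 0` the OPEN events
  `{r < dist γ.source (D.pt 0)}`, `{r < dist γ.target (D.pt 1)}` carry no lattice mass for small
  `δ`, hence no `P D`-mass (portmanteau, `ntb_measure_le_of_tendstoLaw` with `η = 0`); union over
  `r = 1/(n+1)`;
* trace: every edge segment of a SAW of `Ω_δ` lies in `cl Ω` (`embMeshGraph_adj_iff`) and its origin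
  `a δ` is eventually a mesh vertex (`wn_eventually_mem_embMeshDomain`), so the polyline lies in
  `cl D` (`range_toCurve_subset_of_adj` of
  `Theorems/SAWRenewalTightnessShellCrossingBoundSocketTransfer`); the complement of
  `rangeSubset (cl D)` is open
  (`CurveClass.isClosed_rangeSubset`), so it is `P D`-null.

References: P. Billingsley, *Convergence of probability measures*, 2nd ed., Thm 2.1
(portmanteau); M. Aizenman, A. Burchard, Duke Math. J. 99 (1999) §2.1 (curve space; endpoints are
`1`-Lipschitz). No named fact is used; axioms `propext`, `Classical.choice`, `Quot.sound`.
-/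

noncomputable section

namespace Summit.CriticalPhenomena.SAWScalingLimit.Theorems.MassiveWindowSLE.Birth

open scoped BigOperators Topology Classical MeasureTheory NNReal ENNReal BoundedContinuousFunction
open Filter Set MeasureTheory
open Literature.Probability Literature.Probability.LatticeModels Literature.Probability.RandomPlanarGeometry
open Summit.CriticalPhenomena.SAWScalingLimit.Theorems.SAWMassiveIsingTilt (tilt tiltLaw)

/-! ### The trace of a hexagonal SAW lies in the closed domain -/

/-- If the origin `a` is (rescaled) in `cl Ω`, the trace of every SAW of `Ω_δ` from `a` lies in
`cl Ω`: every edge of `Ω_δ` is a mesh edge, whose rescaled segment lies in `cl Ω`. -/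
theorem ch_curve_range_subset {Ω : Set ℂ} {δ : ℝ} {a b : HexVertex} (γ : SAW.HexDomainSAW Ω δ a b)
    (ha : (δ : ℂ) * hexCenter a ∈ closure Ω) : γ.curve.range ⊆ closure Ω := by
  rw [wn_curve_range_eq]
  -- `range_toCurve_subset_of_adj` (Theorems/SAWRenewalTightnessShellCrossingBoundSocketTransfer)
  refine range_toCurve_subset_of_adj (fun u v huv => ?_) γ.walk ha
  exact ((SAW.embMeshGraph_adj_iff hexGraph hexCenter).1
    ((SAW.embDomainGraph_adj_iff hexGraph hexCenter).1 huv).1).2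

/-! ### Masses: a weak limit of eventually-probability laws is a probability measure -/

/-- If laws that are probability measures for all small `δ` converge in law (`TendstoLaw`, test
functions `X →ᵇ ℝ`) to `μ`, then `μ` is a probability measure: the test integral of `f ≡ 1` is the
total mass, eventually `1`, and tends to `μ.real univ`, so `μ univ = 1` (were `μ univ = ∞`, Lean's
`μ.real univ = 0 ≠ 1`). -/
theorem ch_isProbabilityMeasure_of_tendstoLaw {Ωδ : ℝ → Type*} [∀ δ, MeasurableSpace (Ωδ δ)]
    {X : Type*} [TopologicalSpace X] [MeasurableSpace X] {Y : ∀ δ, Ωδ δ → X}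
    {L : ∀ δ, Measure (Ωδ δ)} {μ : Measure X} (hconv : TendstoLaw Y L id μ)
    (hprob : ∀ᶠ δ in 𝓝[>] (0 : ℝ), IsProbabilityMeasure (L δ)) : IsProbabilityMeasure μ := by
  have h1 := hconv (1 : X →ᵇ ℝ)
  simp only [BoundedContinuousFunction.coe_one, Pi.one_apply, integral_const, smul_eq_mul,
    mul_one] at h1
  have h2 : Tendsto (fun δ => (L δ).real univ) (𝓝[>] (0 : ℝ)) (𝓝 1) := by
    refine tendsto_const_nhds.congr' ?_
    filter_upwards [hprob] with δ hδ
    exact probReal_univ.symm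
  have h3 : μ.real univ = 1 := tendsto_nhds_unique h1 h2
  rw [measureReal_def, ENNReal.toReal_eq_one_iff] at h3
  exact ⟨h3⟩

/-- Along an endpoint approximation, a window schedule with `m δ·δ → 0` and an eventually positive
tilt, the window laws are probability measures for all small `δ` (`x δ > 0`,
`y δ = 1/√3 − m δ·δ ≥ 0`, endpoints joined in `Ω_δ`, `δ > 0`). -/
theorem ch_eventually_isProbabilityMeasure_tiltLaw {m x : ℝ → ℝ}
    (hmδ : Tendsto (fun δ => m δ * δ) (𝓝[>] (0 : ℝ)) (𝓝 0))
    (hx : ∀ᶠ δ in 𝓝[>] (0 : ℝ), 0 < x δ) {D : DobrushinDomain} {a b : ℝ → HexVertex}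
    (hab : SAW.IsEmbEndpointApprox hexGraph hexCenter D a b) :
    ∀ᶠ δ in 𝓝[>] (0 : ℝ),
      IsProbabilityMeasure (tiltLaw D.carrier δ (x δ) ((Real.sqrt 3)⁻¹ - m δ * δ) (a δ) (b δ)) := by
  have hy : ∀ᶠ δ in 𝓝[>] (0 : ℝ), m δ * δ < (Real.sqrt 3)⁻¹ :=
    hmδ.eventually (eventually_lt_nhds (by positivity))
  filter_upwards [hab.reachable, self_mem_nhdsWithin, hx, hy] with δ hr hδ hxδ hyδ
  exact SAWMassiveIsingTilt.isProbabilityMeasure_tiltLaw_of_reachable D.isBounded (ne_of_gt hδ) hxδ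
    (sub_nonneg.2 hyδ.le) hr

/-! ### Chordality at one domain, given eventual probability of the window laws -/

/-- **Portmanteau core.** If along an endpoint approximation `(a, b)` of `D` the window laws pushed
to curve classes converge in law to `P D` and are probability measures for small `δ`, then `P D` is
a probability measure carried by curve classes from `D.pt 0` to `D.pt 1` inside `cl D`: the bad
events `{r < dist γ.source (D.pt 0)}`, `{r < dist γ.target (D.pt 1)}` (`r = 1/(n+1)`) and
`{¬ range γ ⊆ cl D}` are open and carry no lattice mass for small `δ` (lattice endpoints
`δ·c(a δ) → D.pt 0`, `δ·c(b δ) → D.pt 1`; lattice polylines lie in `cl D`), hence no `P D`-mass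
(`ntb_measure_le_of_tendstoLaw` with `η = 0`). -/
theorem ch_chordal_at {m x : ℝ → ℝ} {P : ChordalFamily} {D : DobrushinDomain} {a b : ℝ → HexVertex}
    (hab : SAW.IsEmbEndpointApprox hexGraph hexCenter D a b)
    (hconv : TendstoLaw (fun δ (γ : SAW.HexDomainSAW D.carrier δ (a δ) (b δ)) => γ.curve)
      (fun δ => tiltLaw D.carrier δ (x δ) ((Real.sqrt 3)⁻¹ - m δ * δ) (a δ) (b δ)) id (P D))
    (hprob : ∀ᶠ δ in 𝓝[>] (0 : ℝ),
      IsProbabilityMeasure (tiltLaw D.carrier δ (x δ) ((Real.sqrt 3)⁻¹ - m δ * δ) (a δ) (b δ))) :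
    IsProbabilityMeasure (P D) ∧
      ∀ᵐ γ ∂(P D), γ.source = D.pt 0 ∧ γ.target = D.pt 1 ∧ γ.range ⊆ closure D.carrier := by
  haveI hPD : IsProbabilityMeasure (P D) := ch_isProbabilityMeasure_of_tendstoLaw hconv hprob
  -- portmanteau: an open event without lattice mass for small `δ` is `P D`-null
  have hzero : ∀ G : Set (CurveClass ℂ), IsOpen G →
      (∀ᶠ δ in 𝓝[>] (0 : ℝ), ∀ γ : SAW.HexDomainSAW D.carrier δ (a δ) (b δ), γ.curve ∉ G) →
      P D G = 0 := by
    intro G hG hev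
    refine le_antisymm ?_ bot_le
    refine ntb_measure_le_of_tendstoLaw hconv (fun δ => SAW.EmbDomainSAW.measurable_of_top _)
      hprob hG ?_
    filter_upwards [hev] with δ hδ
    rw [Measure.map_apply (SAW.EmbDomainSAW.measurable_of_top _) hG.measurableSet]
    have hempty : (fun γ : SAW.HexDomainSAW D.carrier δ (a δ) (b δ) => γ.curve) ⁻¹' G = ∅ :=
      Set.eq_empty_of_forall_notMem fun γ hγ => hδ γ hγ
    rw [hempty, measure_empty]
  -- the source is `D.pt 0` almost surely
  have hsrc : P D {γ | γ.source ≠ D.pt 0} = 0 := by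
    have hsub : {γ : CurveClass ℂ | γ.source ≠ D.pt 0} ⊆
        ⋃ n : ℕ, {γ | 1 / ((n : ℝ) + 1) < dist γ.source (D.pt 0)} := by
      intro γ hγ
      obtain ⟨n, hn⟩ := exists_nat_one_div_lt (dist_pos.2 hγ)
      exact mem_iUnion.2 ⟨n, hn⟩
    refine measure_mono_null hsub (measure_iUnion_null fun n => hzero _ ?_ ?_)
    · exact isOpen_lt continuous_const (CurveClass.continuous_source.dist continuous_const)
    · have hr : (0 : ℝ) < 1 / ((n : ℝ) + 1) := by positivity
      filter_upwards [Metric.tendsto_nhds.1 hab.tendsto_fst _ hr] with δ hδ γ hγ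
      rw [ObservableToSLE.Negative.source_hexCurve] at hγ
      exact lt_asymm hδ hγ
  -- the target is `D.pt 1` almost surely
  have htgt : P D {γ | γ.target ≠ D.pt 1} = 0 := by
    have hsub : {γ : CurveClass ℂ | γ.target ≠ D.pt 1} ⊆
        ⋃ n : ℕ, {γ | 1 / ((n : ℝ) + 1) < dist γ.target (D.pt 1)} := by
      intro γ hγ
      obtain ⟨n, hn⟩ := exists_nat_one_div_lt (dist_pos.2 hγ)
      exact mem_iUnion.2 ⟨n, hn⟩
    refine measure_mono_null hsub (measure_iUnion_null fun n => hzero _ ?_ ?_)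
    · exact isOpen_lt continuous_const (CurveClass.continuous_target.dist continuous_const)
    · have hr : (0 : ℝ) < 1 / ((n : ℝ) + 1) := by positivity
      filter_upwards [Metric.tendsto_nhds.1 hab.tendsto_snd _ hr] with δ hδ γ hγ
      rw [ObservableToSLE.Negative.target_hexCurve] at hγ
      exact lt_asymm hδ hγ
  -- the trace lies in `cl D` almost surely
  have hrange : P D {γ | ¬ γ.range ⊆ closure D.carrier} = 0 := by
    refine hzero _ ?_ ?_
    · change IsOpen (CurveClass.rangeSubset (closure D.carrier))ᶜ
      exact (CurveClass.isClosed_rangeSubset isClosed_closure).isOpen_compl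
    · filter_upwards [wn_eventually_mem_embMeshDomain hab] with δ hδ γ hγ
      exact hγ (ch_curve_range_subset γ
        (subset_closure (SAW.embMeshDomain_subset hexGraph hexCenter D.carrier δ hδ.2.1)))
  refine ⟨hPD, ?_⟩
  have h1 : ∀ᵐ γ ∂(P D), γ.source = D.pt 0 := by rw [ae_iff]; exact hsrc
  have h2 : ∀ᵐ γ ∂(P D), γ.target = D.pt 1 := by rw [ae_iff]; exact htgt
  have h3 : ∀ᵐ γ ∂(P D), γ.range ⊆ closure D.carrier := by rw [ae_iff]; exact hrange
  filter_upwards [h1, h2, h3] with γ hγ₁ hγ₂ hγ₃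
  exact ⟨hγ₁, hγ₂, hγ₃⟩

/-! ### The registered stub and its mass-form variant -/

/-- **Stub `stub_windowLimitChordal` (registered, skeleton r8; positivity form).** Along a window
schedule with `m δ·δ → 0` and an eventually positive tilt `x δ > 0`, a window-limit family `P` is
chordal: every Dobrushin domain
has a hexagonal endpoint approximation (`HexEndpointApprox.exists_isEmbEndpointApprox`), along
which the window laws are eventually probability measures
(`ch_eventually_isProbabilityMeasure_tiltLaw`), and `ch_chordal_at` (portmanteau) concludes. -/
theorem stub_windowLimitChordal :
    ∀ (m x : ℝ → ℝ) (P : Literature.Probability.RandomPlanarGeometry.ChordalFamily), Filter.Tendsto (fun δ => m δ * δ) (nhdsWithin 0 (Set.Ioi 0)) (nhds 0) → (∀ᶠ δ in nhdsWithin 0 (Set.Ioi 0), 0 < x δ) → (∀ (D : Literature.Probability.RandomPlanarGeometry.DobrushinDomain) (a b : ℝ → Literature.Probability.LatticeModels.HexVertex), Literature.Probability.RandomPlanarGeometry.SAW.IsEmbEndpointApprox Literature.Probability.LatticeModels.hexGraph Literature.Probability.LatticeModels.hexCenter D a b → Literature.Probability.RandomPlanarGeometry.TendstoLaw (fun δ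 (γ : Literature.Probability.RandomPlanarGeometry.SAW.HexDomainSAW D.carrier δ (a δ) (b δ)) => γ.curve) (fun δ => Summit.CriticalPhenomena.SAWScalingLimit.Theorems.SAWMassiveIsingTilt.tiltLaw D.carrier δ (x δ) ((Real.sqrt 3)⁻¹ - m δ * δ) (a δ) (b δ)) id (P D)) → P.IsChordal := by
  intro m x P hmδ hx hW D
  obtain ⟨a, b, hab⟩ := HexEndpointApprox.exists_isEmbEndpointApprox D
  exact ch_chordal_at hab (hW D a b hab) (ch_eventually_isProbabilityMeasure_tiltLaw hmδ hx hab)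

/-- **Corrected stub Ch (mass form).** If every `P D` is a probability measure, a window-limit
family `P` is chordal: the window laws are each a probability measure or `0`
(`ntb_isProbabilityMeasure_tiltLaw_or_eq_zero`) and their masses tend to `1`, so they are
eventually probability measures (`ntb_eventually_isProbabilityMeasure`), and `ch_chordal_at`
(portmanteau) concludes. -/
theorem ch_windowLimitChordal_of_prob :
    ∀ (m x : ℝ → ℝ) (P : Literature.Probability.RandomPlanarGeometry.ChordalFamily), (∀ D : Literature.Probability.RandomPlanarGeometry.DobrushinDomain, MeasureTheory.IsProbabilityMeasure (P D)) → (∀ (D : Literature.Probability.RandomPlanarGeometry.DobrushinDomain) (a b : ℝ → Literature.Probability.LatticeModels.HexVertex), Literature.Probability.RandomPlanarGeometry.SAW.IsEmbEndpointApprox Literature.Probability.LatticeModels.hexGraph Literature.Probability.LatticeModels.hexCenter D a b → Literature.Probability.RandomPlanarGeometry.TendstoLaw (fun δ (γ : Literature.Probability.RandomPlanarGeometry.SAW.HexDomainSAW D.carrier δ (a δ) (b δ)) => γ.curve) (fun δ => Summit.CriticalPhenomena.SAWScalingLimit.Theorems.SAWMassiveIsingTilt.tiltLaw D.carrier δ (x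 δ) ((Real.sqrt 3)⁻¹ - m δ * δ) (a δ) (b δ)) id (P D)) → P.IsChordal := by
  intro m x P hP hW D
  obtain ⟨a, b, hab⟩ := HexEndpointApprox.exists_isEmbEndpointApprox D
  haveI := hP D
  have hconv := hW D a b hab
  exact ch_chordal_at hab hconv (ntb_eventually_isProbabilityMeasure hconv fun δ =>
    ntb_isProbabilityMeasure_tiltLaw_or_eq_zero _ _ _ _ _ _)

/-! ### The r7 signature (without the two hypotheses) is false -/

/-- At fugacity `x = 0` the tilted weight vanishes: every SAW has `ℓ(γ) ≥ 1` vertices, so its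
weight is `0 ^ ℓ(γ) · Zloop = 0`. -/
theorem ch_tilt_zero_fugacity (Ω : Set ℂ) (δ y : ℝ) (a b : HexVertex) : tilt Ω δ 0 y a b = 0 := by
  rw [tilt]
  have h : ∀ γ : SAW.HexDomainSAW Ω δ a b, (0 : ℝ) ^ γ.vertexCount = 0 := fun γ =>
    zero_pow (Nat.succ_ne_zero _)
  simp [h]

/-- At fugacity `x = 0` the tilted interface law is the zero measure (`0⁻¹ • 0 = 0`). -/
theorem ch_tiltLaw_zero_fugacity (Ω : Set ℂ) (δ y : ℝ) (a b : HexVertex) :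
    tiltLaw Ω δ 0 y a b = 0 := by
  rw [tiltLaw, ch_tilt_zero_fugacity, smul_zero]

/-- **The r7 form of the chordality stub (no hypothesis on `m`, `x`) is false.** Witness `m := 0`,
`x := 0`, `P := 0`: at tilt `0` all window laws vanish (`ch_tiltLaw_zero_fugacity`), so they
converge in law to the zero family (both test integrals are `0`), which is not chordal
(`0 univ ≠ 1` at `DobrushinDomain.unitDisc`). -/
theorem ch_not_stub_windowLimitChordal :
    ¬ (∀ (m x : ℝ → ℝ) (P : Literature.Probability.RandomPlanarGeometry.ChordalFamily), (∀ (D : Literature.Probability.RandomPlanarGeometry.DobrushinDomain) (a b : ℝ → Literature.Probability.LatticeModels.HexVertex), Literature.Probability.RandomPlanarGeometry.SAW.IsEmbEndpointApprox Literature.Probability.LatticeModels.hexGraph Literature.Probability.LatticeModels.hexCenter D a b → Literature.Probability.RandomPlanarGeometry.TendstoLaw (fun δ (γ : Literature.Probability.RandomPlanarGeometry.SAW.HexDomainSAW D.carrier δ (a δ) (b δ)) => γ.curve) (fun δ => Summit.CriticalPhenomena.SAWScalingLimit.Theorems.SAWMassiveIsingTilt.tiltLaw D.carrier δ (x δ)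 ((Real.sqrt 3)⁻¹ - m δ * δ) (a δ) (b δ)) id (P D)) → P.IsChordal) := by
  intro h
  have hP : ChordalFamily.IsChordal (fun _ => 0) := by
    refine h 0 0 (fun _ => 0) fun D a b _ f => ?_
    simp only [Pi.zero_apply, ch_tiltLaw_zero_fugacity, integral_zero_measure]
    exact tendsto_const_nhds
  haveI := (hP DobrushinDomain.unitDisc).1
  have h1 : (0 : Measure (CurveClass ℂ)) univ = 1 := measure_univ
  rw [Measure.coe_zero, Pi.zero_apply] at h1
  exact zero_ne_one h1

end Summit.CriticalPhenomena.SAWScalingLimit.Theorems.MassiveWindowSLE.Birth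

end
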